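import Literature.Topology.FourManifolds.SmoothOrientationGluing
import Literature.Topology.FourManifolds.OrientedConnectedSumTransportProofs
import Literature.Topology.FourManifolds.ConnectedSumExistence
import Literature.Topology.FourManifolds.SmoothOrientationProofs
import Mathlib.Analysis.InnerProductSpace.Projection.FiniteDimensional
import Mathlib.LinearAlgebra.Matrix.SchurComplement
import Mathlib.Analysis.SpecialFunctions.Sqrt
import HarnessLib

/-!
# Existence of oriented connected sums (proof of `Literature.Topology.FourManifolds.exists_isOrientedConnectedSum`)

Topic `Literature/Topology/FourManifolds`, sibling of `ConnectedSum.lean` (the relational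
connected sum `Literature.Topology.FourManifolds.IsConnectedSum` / `Literature.Topology.FourManifolds.IsOrientedConnectedSum` of Kervaire–Milnor) and of
`ConnectedSumExistence.lean` (`Literature.Topology.FourManifolds.exists_isConnectedSum_holds`, existence of connected sums of
closed manifolds via the pushout `Literature.Topology.FourManifolds.SmoothGlueData.Glued`). This file discharges the named fact
`Literature.Topology.FourManifolds.exists_isOrientedConnectedSum` (`exists_isOrientedConnectedSum_holds`): two oriented nonempty
closed smooth `n`-manifolds `(M, oM)`, `(N, oN)`, `n ≠ 0`, have an ORIENTED connected sum — a
closed oriented `n`-manifold `(P, oP)` with `IsOrientedConnectedSum oM oN oP` (discs `i₁`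
orientation preserving, `i₂` orientation reversing, and the two open embeddings of the punctured
pieces orientation preserving). It is leaf (ii) of the decomposition of Kervaire–Milnor's
Theorem 1.1 (`Literature.Topology.FourManifolds.exists_commGroup_homotopySphereClass`, files `HomotopySpheres*.lean`).

## Source

M. Kervaire, J. Milnor, *Groups of homotopy spheres I*, Ann. of Math. 77 (1963), §2, p. 505: the
connected sum of connected oriented manifolds is formed from "imbeddings `i₁ : Dⁿ → M₁`,
`i₂ : Dⁿ → M₂`" chosen "so that `i₁` preserves orientation and `i₂` reverses orientation", by
identifying `i₁ (t u)` with `i₂ ((1 - t) u)`; "`M₁ # M₂` … possesses an orientation compatible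
with those of `M₁` and `M₂`" (p. 505, the chosen senses of `i₁`, `i₂` make the identification
orientation preserving). A. Kosinski, *Differential Manifolds* (1993), Ch. VI §1, Theorem (1.1):
"`M₁ # M₂` is a smooth manifold, connected if `m > 1` and oriented if both `M₁`, `M₂` are
oriented."

## Proof

1. *Pointwise calculus of orientation behaviour* (§1): the chain rule for the statement "`f`
   carries `oM x` to `oN (f x)` iff `det df_x > 0`" (`orientationAt_comp`), derivatives of maps
   into / between open submanifolds (`mfderiv_codRestrict_opens_eq`,
   `mfderiv_opens_eq_of_eventuallyEq`).
2. *The disc inversion reverses orientation* (§2): the Jacobian of Kervaire–Milnor's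
   identification `ψ v = ((1 - ‖v‖) ‖v‖⁻¹) • v` at `0 < ‖v‖ < 1` is `-((1 - ‖v‖)/‖v‖)ⁿ⁻¹ < 0`
   (`det_fderiv_discInversionFun`: `dψ` is a scalar plus a rank-one map, and
   `det (c • id + f ⊗ x) = cⁿ⁻¹ (c + f x)`, the matrix determinant lemma).
3. *Oriented data* (§3–§4): every disc `ℝⁿ → M` preserves or reverses orientation (it is a
   diffeomorphism onto its open range, Hirsch §4.4), so there are connected sum data whose first
   disc preserves the orientations `(o₀, oM)`; composing the second chart with a reflection of
   `ℝⁿ` (`exists_linearIsometryEquiv_det_eq_neg_one`, `ConnectedSumData.reflectRight`) if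
   necessary, the second disc reverses `(o₀, oN)` (`exists_connectedSumData_oriented`).
4. *The orientation of `M # N`* (§5): on the glued manifold `P` of `ConnectedSumExistence`, the
   orientations `oM|`, `oN|` of the punctured pieces are pushed forward along the open embeddings
   `jA`, `jB` (`Literature.Topology.FourManifolds.SmoothOrientation.map`, `Literature.Topology.FourManifolds.rangeDiffeomorph`) and glued
   (`Literature.Topology.FourManifolds.SmoothOrientation.glue`); they agree on the overlap because there `jA = jB ∘ φ` with the
   identification `φ = i₂ ∘ ψ ∘ e₁` orientation preserving — `e₁ = i₁⁻¹` preserves, `ψ` and `i₂`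
   reverse (`ConnectedSumData.orientationAt_φ`, `ConnectedSumData.oUA_eq_oUB`). By construction
   `jA`, `jB` are orientation preserving, which is `IsOrientedConnectedSum oM oN oP`
   (`ConnectedSumData.isOrientedConnectedSum_glued`).

## Main statements

* `Literature.Topology.FourManifolds.det_fderiv_discInversionFun`, `Literature.Topology.FourManifolds.det_fderiv_discInversionFun_neg`;
* `Literature.Topology.FourManifolds.exists_connectedSumData_oriented`;
* `Literature.Topology.FourManifolds.ConnectedSumData.orientation`, `Literature.Topology.FourManifolds.ConnectedSumData.isOrientedConnectedSum_glued`;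
* `Literature.exists_isOrientedConnectedSum_holds : exists_isOrientedConnectedSum`.

## References

* M. Kervaire, J. Milnor, *Groups of homotopy spheres I*, Ann. of Math. (2) 77 (1963), §2,
  p. 505. [KervaireMilnorAnnals1963] (cited in `ConnectedSum*.lean` as [KervaireMilnor1963])
* A. Kosinski, *Differential Manifolds*, Academic Press (1993), Ch. VI §1, Thm (1.1). [Kosinski1993]
* M. W. Hirsch, *Differential Topology*, GTM 33 (1976), Ch. 4 §4, p. 101. [HirschDT1976]
* J. M. Lee, *Introduction to Smooth Manifolds*, 2nd ed. (2013), Example 1.26, Prop. 3.9.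
-/

open scoped Manifold ContDiff Topology RealInnerProductSpace
open Set Module Function Filter OpenPartialHomeomorph Matrix

noncomputable section

namespace Literature.Topology.FourManifolds

universe u v

/-- Local notation: `𝔼 n` is the model Euclidean space `EuclideanSpace ℝ (Fin n)`. -/
local notation "𝔼 " n:arg => EuclideanSpace ℝ (Fin n)

/-! ### Pointwise orientation behaviour of composites -/

section Pointwise

variable {E H H' H'' : Type*} [NormedAddCommGroup E] [NormedSpace ℝ E] [TopologicalSpace H]
  [TopologicalSpace H'] [TopologicalSpace H''] {I : ModelWithCorners ℝ E H}
  {I' : ModelWithCorners ℝ E H'} {I'' : ModelWithCorners ℝ E H''}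
  {M : Type*} [TopologicalSpace M] [ChartedSpace H M] [IsManifold I 1 M]
  {N : Type*} [TopologicalSpace N] [ChartedSpace H' N] [IsManifold I' 1 N]
  {P : Type*} [TopologicalSpace P] [ChartedSpace H'' P] [IsManifold I'' 1 P]

/-- **Pointwise chain rule for orientation behaviour.** If `f` carries `oM x` to `oN (f x)`
exactly when `det df_x > 0`, and `g` carries `oN (f x)` to `oP (g (f x))` exactly when
`det dg_{f x} > 0` (both differentials invertible), then `g ∘ f` carries `oM x` to `oP (g (f x))`
exactly when `det d(g ∘ f)_x > 0`: chain rule and multiplicativity of `det`, with the parity rule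
for the two orientations of a fibre (Hirsch, *Differential Topology* (1976), §4.4, p. 101; the
pointwise form of `Literature.Topology.FourManifolds.IsOrientationPreserving.comp_holds`). [cite: HirschDT1976, §4.4 p. 101] -/
theorem orientationAt_comp {oM : SmoothOrientation I M} {oN : SmoothOrientation I' N}
    {oP : SmoothOrientation I'' P} {f : M → N} {g : N → P} {x : M}
    (hfd : MDifferentiableAt I I' f x) (hgd : MDifferentiableAt I' I'' g (f x))
    (hf0 : LinearMap.det (M := E) (mfderiv I I' f x).toLinearMap ≠ 0)
    (hg0 : LinearMap.det (M := E) (mfderiv I' I'' g (f x)).toLinearMap ≠ 0)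
    (hf : oN (f x) = oM x ↔ 0 < LinearMap.det (M := E) (mfderiv I I' f x).toLinearMap)
    (hg : oP (g (f x)) = oN (f x) ↔
      0 < LinearMap.det (M := E) (mfderiv I' I'' g (f x)).toLinearMap) :
    oP (g (f x)) = oM x ↔
      0 < LinearMap.det (M := E) (mfderiv I I'' (g ∘ f) x).toLinearMap := by
  have hchain : mfderiv I I'' (g ∘ f) x = (mfderiv I' I'' g (f x)).comp (mfderiv I I' f x) :=
    mfderiv_comp x hgd hfd
  have hdet : LinearMap.det (M := E) (mfderiv I I'' (g ∘ f) x).toLinearMap =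
      LinearMap.det (M := E) (mfderiv I' I'' g (f x)).toLinearMap *
        LinearMap.det (M := E) (mfderiv I I' f x).toLinearMap := by
    rw [hchain]
    exact LinearMap.det_comp (M := E) (mfderiv I' I'' g (f x)).toLinearMap
      (mfderiv I I' f x).toLinearMap
  rw [hdet, mul_pos_iff_pos_iff_pos hg0 hf0, ← hf, ← hg]
  exact orientation_eq_iff_eq_iff_eq _ _ _

/-- Pointwise orientation behaviour is insensitive to reversing both orientations. [folklore] -/
theorem orientationAt_neg_neg_iff {oM : SmoothOrientation I M} {oN : SmoothOrientation I' N}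
    {f : M → N} {x : M} {D : Prop} :
    ((-oN) (f x) = (-oM) x ↔ D) ↔ (oN (f x) = oM x ↔ D) := by
  refine iff_congr ?_ Iff.rfl
  exact neg_inj (a := oN (f x)) (b := oM x)

/-- Pointwise orientation behaviour of a map with negative Jacobian towards a constant
orientation and its opposite: "`-o = o ↔ 0 < det`" holds when `det < 0`. [folklore] -/
theorem orientationAt_of_det_neg {o : Orientation ℝ E (Fin (finrank ℝ E))} {d : ℝ} (hd : d < 0) :
    (-o = o ↔ 0 < d) :=
  iff_of_false (fun h => Module.Ray.ne_neg_self o h.symm) (lt_asymm hd)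

end Pointwise

/-! ### Derivatives of maps into open submanifolds -/

section CodRestrict

variable {E H E' H' : Type*} [NormedAddCommGroup E] [NormedSpace ℝ E] [TopologicalSpace H]
  {I : ModelWithCorners ℝ E H} [NormedAddCommGroup E'] [NormedSpace ℝ E'] [TopologicalSpace H']
  {I' : ModelWithCorners ℝ E' H'}
  {X : Type*} [TopologicalSpace X] [ChartedSpace H X]
  {M' : Type*} [TopologicalSpace M'] [ChartedSpace H' M']
  {U' : TopologicalSpace.Opens M'} {f : X → M'} {g : X → U'}

/-- The local representative of a corestriction `g : X → U'` of `f : X → M'` to an open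
submanifold `U'` (`↑(g y) = f y`) in the preferred charts at `x`, `g x` is that of `f` (the chart
of `U'` at `g x` is the restricted chart of `M'` at `f x`; Lee, *Introduction to Smooth
Manifolds* (2013), Example 1.26). [folklore] -/
theorem writtenInExtChartAt_codRestrict_opens (hfg : ∀ y, (g y : M') = f y) (x : X) :
    writtenInExtChartAt I I' x g = writtenInExtChartAt I I' x f := by
  funext z
  simp only [writtenInExtChartAt, Function.comp_apply, extChartAt_coe,
    TopologicalSpace.Opens.chartAt_eq, OpenPartialHomeomorph.subtypeRestr_coe, restrict_apply, hfg]

/-- A corestriction `g : X → U'` of `f` to an open submanifold has at `x` every manifold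
derivative that `f` has (Lee (2013), Prop. 3.9: `T_p U = T_p M`). [folklore] -/
theorem hasMFDerivAt_codRestrict_opens (hfg : ∀ y, (g y : M') = f y) {x : X} {f' : E →L[ℝ] E'}
    (hf : HasMFDerivAt I I' f x f') : HasMFDerivAt I I' g x f' := by
  refine ⟨?_, ?_⟩
  · rw [Topology.IsInducing.subtypeVal.continuousAt_iff]
    exact hf.1.congr_of_eventuallyEq (Filter.Eventually.of_forall hfg)
  · have heq : writtenInExtChartAt I I' x g =ᶠ[𝓝 ((extChartAt I x) x)]
        writtenInExtChartAt I I' x f :=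
      Filter.Eventually.of_forall fun z =>
        congrFun (writtenInExtChartAt_codRestrict_opens (I := I) (I' := I') hfg x) z
    exact hf.2.congr_of_eventuallyEq (heq.filter_mono nhdsWithin_le_nhds) heq.eq_of_nhds

/-- The manifold derivative of a corestriction `g : X → U'` of `f` to an open submanifold is that
of `f` (Lee (2013), Prop. 3.9). [folklore] -/
theorem mfderiv_codRestrict_opens_eq (hfg : ∀ y, (g y : M') = f y) {x : X}
    (hf : MDifferentiableAt I I' f x) : mfderiv I I' g x = mfderiv I I' f x :=
  (hasMFDerivAt_codRestrict_opens hfg hf.hasMFDerivAt).mfderiv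

/-- A corestriction to an open submanifold is differentiable where the map is. [folklore] -/
theorem mdifferentiableAt_codRestrict_opens (hfg : ∀ y, (g y : M') = f y) {x : X}
    (hf : MDifferentiableAt I I' f x) : MDifferentiableAt I I' g x :=
  (hasMFDerivAt_codRestrict_opens hfg hf.hasMFDerivAt).mdifferentiableAt

end CodRestrict

/-! ### Derivatives of maps between open submanifolds agreeing near a point -/

section OpensEventually

variable {E H E' H' : Type*} [NormedAddCommGroup E] [NormedSpace ℝ E] [TopologicalSpace H]
  {I : ModelWithCorners ℝ E H} [NormedAddCommGroup E'] [NormedSpace ℝ E'] [TopologicalSpace H']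
  {I' : ModelWithCorners ℝ E' H'}
  {M : Type*} [TopologicalSpace M] [ChartedSpace H M]
  {M' : Type*} [TopologicalSpace M'] [ChartedSpace H' M']
  {U : TopologicalSpace.Opens M} {U' : TopologicalSpace.Opens M'} {f : M → M'} {g : U → U'}

/-- If `g : U → U'` agrees NEAR `x` with the restriction of `f : M → M'` to open submanifolds,
then near the base point the local representatives of `g` (charts of `U`, `U'` at `x`, `g x`)
and of `f` (charts of `M`, `M'` at `↑x`, `f ↑x`) agree (Lee (2013), Example 1.26, Prop. 3.9).
[folklore] -/
theorem writtenInExtChartAt_opens_eventuallyEq_of_eventuallyEq {x₀ : U}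
    (hfg : ∀ᶠ y in 𝓝 x₀, (g y : M') = f y) :
    writtenInExtChartAt I I' x₀ g =ᶠ[𝓝 ((extChartAt I x₀) x₀)]
      writtenInExtChartAt I I' (x₀ : M) f := by
  have hgx : (g x₀ : M') = f x₀ := hfg.self_of_nhds
  have h1 := TopologicalSpace.Opens.chartAt_subtype_val_symm_eventuallyEq (H := H) U (x := x₀)
  have h2 : ContinuousAt I.symm ((extChartAt I x₀) x₀) := I.continuous_symm.continuousAt
  have h3 : I.symm ((extChartAt I x₀) x₀) = chartAt H (x₀ : M) x₀ := by
    simp only [extChartAt_coe, Function.comp_apply, ModelWithCorners.left_inv]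
    rfl
  rw [ContinuousAt, h3] at h2
  -- pull `hfg` back along the inverse extended chart of `U` at `x₀`
  have h4 : ContinuousAt (extChartAt I x₀).symm ((extChartAt I x₀) x₀) :=
    continuousAt_extChartAt_symm x₀
  have h5 : (extChartAt I x₀).symm ((extChartAt I x₀) x₀) = x₀ := extChartAt_to_inv x₀
  rw [ContinuousAt, h5] at h4
  filter_upwards [h2.eventually h1, h4.eventually hfg] with z hz hz'
  simp only [writtenInExtChartAt, Function.comp_apply, extChartAt_coe, extChartAt_coe_symm,
    TopologicalSpace.Opens.chartAt_eq, OpenPartialHomeomorph.subtypeRestr_coe, restrict_apply]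
  simp only [Function.comp_apply, TopologicalSpace.Opens.chartAt_eq] at hz
  simp only [extChartAt_coe_symm, Function.comp_apply, TopologicalSpace.Opens.chartAt_eq] at hz'
  rw [hgx, hz', ← hz]

/-- If `g : U → U'` agrees near `x` with the restriction of `f` to open submanifolds, then `g`
has at `x` every manifold derivative that `f` has at `↑x` (Lee (2013), Prop. 3.9). [folklore] -/
theorem hasMFDerivAt_opens_of_eventuallyEq {x : U} (hfg : ∀ᶠ y in 𝓝 x, (g y : M') = f y)
    {f' : E →L[ℝ] E'} (hf : HasMFDerivAt I I' f (x : M) f') : HasMFDerivAt I I' g x f' := by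
  have hgx : (g x : M') = f x := hfg.self_of_nhds
  refine ⟨?_, ?_⟩
  · rw [Topology.IsInducing.subtypeVal.continuousAt_iff]
    have hc : ContinuousAt (f ∘ Subtype.val) x := hf.1.comp continuous_subtype_val.continuousAt
    exact hc.congr_of_eventuallyEq hfg
  · have heq := writtenInExtChartAt_opens_eventuallyEq_of_eventuallyEq (I := I) (I' := I') hfg
    exact hf.2.congr_of_eventuallyEq (heq.filter_mono nhdsWithin_le_nhds) heq.eq_of_nhds

/-- The manifold derivative of `g : U → U'`, agreeing near `x` with the restriction of `f` to
open submanifolds, is that of `f` at `↑x` (Lee (2013), Prop. 3.9). [folklore] -/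
theorem mfderiv_opens_eq_of_eventuallyEq {x : U} (hfg : ∀ᶠ y in 𝓝 x, (g y : M') = f y)
    (hf : MDifferentiableAt I I' f (x : M)) : mfderiv I I' g x = mfderiv I I' f (x : M) :=
  (hasMFDerivAt_opens_of_eventuallyEq hfg hf.hasMFDerivAt).mfderiv

/-- `g : U → U'`, agreeing near `x` with the restriction of `f`, is differentiable at `x` if `f`
is differentiable at `↑x`. [folklore] -/
theorem mdifferentiableAt_opens_of_eventuallyEq {x : U}
    (hfg : ∀ᶠ y in 𝓝 x, (g y : M') = f y) (hf : MDifferentiableAt I I' f (x : M)) : MDifferentiableAt I I' g x :=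
  (hasMFDerivAt_opens_of_eventuallyEq hfg hf.hasMFDerivAt).mdifferentiableAt

end OpensEventually

/-! ### The Jacobian of Kervaire–Milnor's disc inversion -/

section DiscInversion
variable {n : ℕ}

/-- **Determinant of a scalar plus a rank-one map** (matrix determinant lemma): on `ℝⁿ`, `n ≠ 0`,
`det (c • id + f ⊗ x) = cⁿ⁻¹ (c + f x)` for `c ≠ 0`, a linear form `f` and a vector `x`. [folklore] -/
theorem det_smul_id_add_smulRight (hn : n ≠ 0) {c : ℝ} (hc : c ≠ 0) (f : (𝔼 n) →ₗ[ℝ] ℝ)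
    (x : 𝔼 n) :
    LinearMap.det (c • LinearMap.id + f.smulRight x : (𝔼 n) →ₗ[ℝ] (𝔼 n)) =
      c ^ (n - 1) * (c + f x) := by
  set b := (EuclideanSpace.basisFun (Fin n) ℝ).toBasis with hb
  rw [← LinearMap.det_toMatrix b, map_add, LinearEquiv.map_smul, LinearMap.toMatrix_id,
    LinearMap.toMatrix_smulRight]
  have hfac : c • (1 : Matrix (Fin n) (Fin n) ℝ) + vecMulVec (b.repr x) (f ∘ b) =
      c • (1 + vecMulVec (c⁻¹ • ⇑(b.repr x)) (f ∘ b)) := by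
    rw [smul_add, ← smul_vecMulVec, smul_inv_smul₀ hc]
  rw [hfac, det_smul, Fintype.card_fin, vecMulVec_eq Unit,
    det_one_add_replicateCol_mul_replicateRow]
  have hsum : (f ∘ ⇑b) ⬝ᵥ (c⁻¹ • ⇑(b.repr x)) = c⁻¹ * f x := by
    simp only [dotProduct, Function.comp_apply, Pi.smul_apply, smul_eq_mul]
    have hx : ∑ i, (b.repr x i) • b i = x := b.sum_repr x
    calc ∑ i, f (b i) * (c⁻¹ * b.repr x i)
        = c⁻¹ * ∑ i, b.repr x i * f (b i) := by
          rw [Finset.mul_sum]; exact Finset.sum_congr rfl fun i _ => by ring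
      _ = c⁻¹ * f (∑ i, (b.repr x i) • b i) := by
          rw [map_sum]; simp only [map_smul, smul_eq_mul]
      _ = c⁻¹ * f x := by rw [hx]
  rw [hsum]
  obtain ⟨m, rfl⟩ := Nat.exists_eq_succ_of_ne_zero hn
  rw [Nat.succ_sub_one, pow_succ]
  field_simp

/-- The derivative of the norm of a real inner product space at a nonzero vector:
`d‖·‖(v) = ‖v‖⁻¹ ⟪v, ·⟫`. [folklore] -/
theorem hasFDerivAt_norm_of_ne_zero {F : Type*} [NormedAddCommGroup F] [InnerProductSpace ℝ F]
    {v : F} (hv : v ≠ 0) : HasFDerivAt (fun y : F => ‖y‖) (‖v‖⁻¹ • innerSL ℝ v) v := by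
  have h1 : HasFDerivAt (fun y : F => Real.sqrt (‖y‖ ^ 2))
      ((1 / (2 * Real.sqrt (‖v‖ ^ 2))) • (2 • innerSL ℝ v)) v :=
    (hasStrictFDerivAt_norm_sq v).hasFDerivAt.sqrt (by positivity)
  have h2 : (fun y : F => Real.sqrt (‖y‖ ^ 2)) = fun y => ‖y‖ :=
    funext fun y => Real.sqrt_sq (norm_nonneg y)
  rw [h2, Real.sqrt_sq (norm_nonneg v)] at h1
  convert h1 using 1
  ext w
  simp only [_root_.smul_apply, smul_eq_mul, two_smul, _root_.add_apply]
  field_simp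
  ring

/-- **The derivative of Kervaire–Milnor's disc inversion** `ψ v = ((1 - ‖v‖) ‖v‖⁻¹) • v` at
`v ≠ 0` is a scalar plus a rank-one map: `dψ_v = ((1 - ‖v‖) ‖v‖⁻¹) • id + g' ⊗ v` for a linear
form `g'` (the derivative of `(1 - ‖v‖) ‖v‖⁻¹`) with `g' v = -‖v‖⁻¹` (Kervaire–Milnor 1963, §2).
[folklore] -/
theorem exists_hasFDerivAt_discInversionFun {v : 𝔼 n} (hv : v ≠ 0) :
    ∃ g' : (𝔼 n) →L[ℝ] ℝ, g' v = -‖v‖⁻¹ ∧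
      HasFDerivAt (discInversionFun : 𝔼 n → 𝔼 n)
        (((1 - ‖v‖) * ‖v‖⁻¹) • ContinuousLinearMap.id ℝ (𝔼 n) + g'.smulRight v) v := by
  have hN := hasFDerivAt_norm_of_ne_zero hv
  have hn0 : ‖v‖ ≠ 0 := norm_ne_zero_iff.2 hv
  have hinv : HasFDerivAt (fun y : 𝔼 n => ‖y‖⁻¹)
      ((ContinuousLinearMap.toSpanSingleton ℝ (-(‖v‖ ^ 2)⁻¹)).comp (‖v‖⁻¹ • innerSL ℝ v)) v :=
    (hasFDerivAt_inv hn0).comp v hN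
  have hg := (hN.const_sub 1).mul hinv
  refine ⟨_, ?_, hg.smul (hasFDerivAt_id v)⟩
  simp only [_root_.add_apply, _root_.smul_apply, _root_.neg_apply,
    ContinuousLinearMap.comp_apply, ContinuousLinearMap.toSpanSingleton_apply, innerSL_apply_apply,
    real_inner_self_eq_norm_sq, smul_eq_mul]
  field_simp
  ring

/-- **The disc inversion reverses orientation**: the Jacobian determinant of
`ψ v = ((1 - ‖v‖) ‖v‖⁻¹) • v` at `0 < ‖v‖ < 1` is `-((1 - ‖v‖) ‖v‖⁻¹)ⁿ⁻¹ < 0` (eigenvalue `-1` on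
`ℝ v`, eigenvalue `(1 - ‖v‖)/‖v‖` on `v^⊥`; Kervaire–Milnor 1963, §2: the identification
`t u ↦ (1 - t) u` is orientation reversing, whence `i₂` is taken orientation reversing). [folklore] -/
theorem det_fderiv_discInversionFun (hn : n ≠ 0) {v : 𝔼 n} (hv : 0 < ‖v‖) (hv1 : ‖v‖ < 1) :
    LinearMap.det ((fderiv ℝ (discInversionFun : 𝔼 n → 𝔼 n) v : (𝔼 n) →L[ℝ] (𝔼 n)) :
      (𝔼 n) →ₗ[ℝ] (𝔼 n)) = -((1 - ‖v‖) * ‖v‖⁻¹) ^ (n - 1) := by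
  have hv0 : v ≠ 0 := norm_pos_iff.1 hv
  have hn0 : ‖v‖ ≠ 0 := hv.ne'
  obtain ⟨g', hg'v, hd⟩ := exists_hasFDerivAt_discInversionFun hv0
  rw [hd.fderiv]
  set c : ℝ := (1 - ‖v‖) * ‖v‖⁻¹ with hc_def
  have hc : c ≠ 0 := mul_ne_zero (sub_ne_zero.2 (ne_of_gt hv1)) (inv_ne_zero hn0)
  have hcoe : ((c • ContinuousLinearMap.id ℝ (𝔼 n) + g'.smulRight v : (𝔼 n) →L[ℝ] (𝔼 n)) :
      (𝔼 n) →ₗ[ℝ] (𝔼 n)) = c • LinearMap.id + (g' : (𝔼 n) →ₗ[ℝ] ℝ).smulRight v := by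
    ext w
    rfl
  rw [hcoe, det_smul_id_add_smulRight hn hc]
  have hg'v' : (g' : (𝔼 n) →ₗ[ℝ] ℝ) v = -‖v‖⁻¹ := hg'v
  rw [hg'v', hc_def]
  have : (1 - ‖v‖) * ‖v‖⁻¹ + -‖v‖⁻¹ = -1 := by field_simp; ring
  rw [this, mul_neg_one]

/-- The Jacobian determinant of the disc inversion on the punctured open unit disc is negative
(`n ≠ 0`). [folklore] -/
theorem det_fderiv_discInversionFun_neg (hn : n ≠ 0) {v : 𝔼 n} (hv : 0 < ‖v‖) (hv1 : ‖v‖ < 1) :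
    LinearMap.det ((fderiv ℝ (discInversionFun : 𝔼 n → 𝔼 n) v : (𝔼 n) →L[ℝ] (𝔼 n)) :
      (𝔼 n) →ₗ[ℝ] (𝔼 n)) < 0 := by
  rw [det_fderiv_discInversionFun hn hv hv1, neg_lt_zero]
  exact pow_pos (mul_pos (sub_pos.2 hv1) (inv_pos.2 hv)) _

end DiscInversion

/-! ### Reflections of `ℝⁿ` -/

section Reflection

variable {n : ℕ}

/-- `ℝⁿ`, `n ≠ 0`, has a linear isometry of determinant `-1`: the reflection in the hyperplane
orthogonal to the first basis vector (Mathlib `Submodule.reflection`, `Submodule.det_reflection`).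
[folklore] -/
theorem exists_linearIsometryEquiv_det_eq_neg_one (hn : n ≠ 0) :
    ∃ R : (𝔼 n) ≃ₗᵢ[ℝ] (𝔼 n), LinearMap.det (R.toLinearEquiv : (𝔼 n) →ₗ[ℝ] (𝔼 n)) = -1 := by
  obtain ⟨m, rfl⟩ := Nat.exists_eq_succ_of_ne_zero hn
  set e₀ : 𝔼 (m + 1) := EuclideanSpace.single 0 1 with he₀_def
  have he₀ : e₀ ≠ 0 := fun h => by
    have := congrArg (fun v : 𝔼 (m + 1) => v 0) h
    simp [he₀_def] at this
  set K : Submodule ℝ (𝔼 (m + 1)) := (ℝ ∙ e₀)ᗮ with hK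
  refine ⟨K.reflection, ?_⟩
  have h := K.det_reflection
  have hKo : Kᗮ = ℝ ∙ e₀ := Submodule.orthogonal_orthogonal _
  rw [hKo, finrank_span_singleton he₀, pow_one] at h
  exact h

end Reflection

/-! ### Charts composed with diffeomorphisms of the model, and reflected connected sum data -/

section Data


variable {n : ℕ} {M : Type u} {N : Type v} [TopologicalSpace M] [ChartedSpace (𝔼 n) M]
  [TopologicalSpace N] [ChartedSpace (𝔼 n) N]

/-- A chart of the maximal `C^∞` atlas composed with a self-homeomorphism of the model space which
is `C^∞` in both directions is again in the maximal atlas (Kosinski, *Differential Manifolds*,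
I.(1.1)–(1.2); Mathlib `OpenPartialHomeomorph.mem_maximalAtlas_of_contMDiffOn`). [folklore] -/
theorem trans_toOpenPartialHomeomorph_mem_maximalAtlas [IsManifold (𝓡 n) ∞ N]
    {e : OpenPartialHomeomorph N (𝔼 n)} (he : e ∈ IsManifold.maximalAtlas (𝓡 n) ∞ N)
    (T : (𝔼 n) ≃ₜ (𝔼 n)) (hT : ContMDiff (𝓡 n) (𝓡 n) ∞ T)
    (hT' : ContMDiff (𝓡 n) (𝓡 n) ∞ T.symm) :
    e ≫ₕ T.toOpenPartialHomeomorph ∈ IsManifold.maximalAtlas (𝓡 n) ∞ N := by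
  apply OpenPartialHomeomorph.mem_maximalAtlas_of_contMDiffOn
  · rw [trans_source, Homeomorph.toOpenPartialHomeomorph_source, preimage_univ, inter_univ,
      coe_trans, Homeomorph.toOpenPartialHomeomorph_apply]
    exact hT.comp_contMDiffOn (contMDiffOn_of_mem_maximalAtlas he)
  · rw [trans_target, Homeomorph.toOpenPartialHomeomorph_target, univ_inter, trans_symm_eq_symm_trans_symm,
      coe_trans]
    refine (contMDiffOn_symm_of_mem_maximalAtlas he).comp hT'.contMDiffOn ?_
    intro x hx
    simpa only [mem_preimage, Homeomorph.toOpenPartialHomeomorph_symm_apply] using hx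

namespace ConnectedSumData

variable (D : ConnectedSumData n M N)

/-- Connected sum data with the second chart composed with a linear isometry `R` of `ℝⁿ` (used
with a reflection, to make the second disc orientation reversing: Kervaire–Milnor 1963, §2,
"`i₂` … orientation reversing"; Kosinski VI.1, proof of (1.1)). [cite: KervaireMilnor1963, §2] -/
def reflectRight [IsManifold (𝓡 n) ∞ N] (R : (𝔼 n) ≃ₗᵢ[ℝ] (𝔼 n)) : ConnectedSumData n M N where
  e₁ := D.e₁
  e₂ := D.e₂ ≫ₕ R.toHomeomorph.toOpenPartialHomeomorph
  mem_maximalAtlas₁ := D.mem_maximalAtlas₁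
  mem_maximalAtlas₂ :=
    trans_toOpenPartialHomeomorph_mem_maximalAtlas D.mem_maximalAtlas₂ R.toHomeomorph
      (R : (𝔼 n) →L[ℝ] (𝔼 n)).contDiff.contMDiff
      (R.symm : (𝔼 n) →L[ℝ] (𝔼 n)).contDiff.contMDiff
  target₁ := D.target₁
  target₂ := by
    rw [trans_target, Homeomorph.toOpenPartialHomeomorph_target, univ_inter, D.target₂,
      preimage_univ]

/-- The first disc of the reflected data is unchanged. [folklore] -/
@[simp] theorem reflectRight_i₁ [IsManifold (𝓡 n) ∞ N] (R : (𝔼 n) ≃ₗᵢ[ℝ] (𝔼 n)) :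
    (D.reflectRight R).i₁ = D.i₁ := rfl

/-- The second disc of the reflected data is `i₂ ∘ R⁻¹`. [folklore] -/
theorem reflectRight_i₂ [IsManifold (𝓡 n) ∞ N] (R : (𝔼 n) ≃ₗᵢ[ℝ] (𝔼 n)) :
    (D.reflectRight R).i₂ = D.i₂ ∘ R.symm := by
  funext v
  rfl

/-- The range of the first disc is the (open) source of the first chart. [folklore] -/
theorem range_i₁ : range D.i₁ = D.e₁.source := by
  rw [i₁, ← D.e₁.symm_image_target_eq_source, D.target₁, image_univ]

/-- The range of the second disc is the (open) source of the second chart. [folklore] -/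
theorem range_i₂ : range D.i₂ = D.e₂.source := by
  rw [i₂, ← D.e₂.symm_image_target_eq_source, D.target₂, image_univ]

/-- The range of the first disc is open. [folklore] -/
theorem isOpen_range_i₁ : IsOpen (range D.i₁) := D.range_i₁ ▸ D.e₁.open_source

/-- The range of the second disc is open. [folklore] -/
theorem isOpen_range_i₂ : IsOpen (range D.i₂) := D.range_i₂ ▸ D.e₂.open_source

end ConnectedSumData

end Data

/-! ### Discs preserve or reverse orientation -/

section Disc

variable {n : ℕ} {M : Type*} [TopologicalSpace M] [ChartedSpace (𝔼 n) M] [IsManifold (𝓡 n) ∞ M]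

/-- **A disc preserves or reverses orientation.** A `C^∞` embedding `i : ℝⁿ → M` with open range
into an oriented `n`-manifold either preserves or reverses the orientations
`(constant o, oM)`: it is a diffeomorphism onto its (open) range (`Literature.Topology.FourManifolds.rangeDiffeomorph`), to
which Hirsch's dichotomy for diffeomorphisms out of a connected manifold applies
(`Diffeomorph.isOrientationPreserving_or_isOrientationReversing_holds`; Hirsch, *Differential
Topology* (1976), §4.4, p. 101). [cite: HirschDT1976, §4.4 p. 101] -/
theorem isOrientationPreserving_or_isOrientationReversing_disc {i : 𝔼 n → M}
    (hi : Manifold.IsSmoothEmbedding 𝓘(ℝ, 𝔼 n) (𝓡 n) ∞ i) (ho : IsOpen (range i))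
    (o : Orientation ℝ (𝔼 n) (Fin (finrank ℝ (𝔼 n)))) (oM : SmoothOrientation (𝓡 n) M) :
    IsOrientationPreserving (SmoothOrientation.modelSpace o) oM i ∨
      IsOrientationReversing (SmoothOrientation.modelSpace o) oM i := by
  set ψ := rangeDiffeomorph hi ho with hψ
  have hcoe : ∀ v, ((ψ v : rangeOpens i ho) : M) = i v := fun v => rfl
  have hd : ∀ v, mfderiv 𝓘(ℝ, 𝔼 n) (𝓡 n) ψ v = mfderiv 𝓘(ℝ, 𝔼 n) (𝓡 n) i v := fun v =>
    mfderiv_codRestrict_opens_eq hcoe ((hi.contMDiff v).mdifferentiableAt (by simp))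
  rcases Diffeomorph.isOrientationPreserving_or_isOrientationReversing_holds ψ (by simp)
    (SmoothOrientation.modelSpace o) (oM.restrict (rangeOpens i ho)) with h | h
  · left
    intro v
    rw [← hd v]
    exact h v
  · right
    intro v
    rw [← hd v]
    exact h v

/-- Every disc (`C^∞` embedding `ℝⁿ → M` with open range) into an oriented manifold is orientation
preserving for a suitable constant orientation of `ℝⁿ` (replace `o` by `-o` if the disc reverses;
Kervaire–Milnor 1963, §2: "`i₁` … orientation preserving"). [folklore] -/
theorem exists_isOrientationPreserving_disc {i : 𝔼 n → M}
    (hi : Manifold.IsSmoothEmbedding 𝓘(ℝ, 𝔼 n) (𝓡 n) ∞ i) (ho : IsOpen (range i))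
    (oM : SmoothOrientation (𝓡 n) M) :
    ∃ o : Orientation ℝ (𝔼 n) (Fin (finrank ℝ (𝔼 n))),
      IsOrientationPreserving (SmoothOrientation.modelSpace o) oM i := by
  obtain ⟨o⟩ := nonempty_orientation (𝔼 n)
  rcases isOrientationPreserving_or_isOrientationReversing_disc hi ho o oM with h | h
  · exact ⟨o, h⟩
  · refine ⟨-o, ?_⟩
    rw [← SmoothOrientation.neg_modelSpace, ← isOrientationReversing_iff_neg]
    exact h

/-- **Precomposing a disc with a linear map of negative determinant flips its orientation
behaviour**: if `i : ℝⁿ → M` preserves the orientations `(o, oM)` and `R` is a linear isometry of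
`ℝⁿ` with `det R < 0`, then `i ∘ R` reverses them (chain rule; Kervaire–Milnor 1963, §2: compose
a disc with a reflection to make it orientation reversing). [folklore] -/
theorem isOrientationReversing_disc_comp {i : 𝔼 n → M}
    (hi : Manifold.IsSmoothEmbedding 𝓘(ℝ, 𝔼 n) (𝓡 n) ∞ i) (ho : IsOpen (range i))
    {o : Orientation ℝ (𝔼 n) (Fin (finrank ℝ (𝔼 n)))} {oM : SmoothOrientation (𝓡 n) M}
    (h : IsOrientationPreserving (SmoothOrientation.modelSpace o) oM i)
    (R : (𝔼 n) ≃ₗᵢ[ℝ] (𝔼 n)) (hR : LinearMap.det (R.toLinearEquiv : (𝔼 n) →ₗ[ℝ] (𝔼 n)) < 0) :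
    IsOrientationReversing (SmoothOrientation.modelSpace o) oM (i ∘ R) := by
  -- `R : (ℝⁿ, o) → (ℝⁿ, -o)` is orientation preserving, `i : (ℝⁿ, -o) → (M, -oM)` too
  have hRd : ∀ v, mfderiv 𝓘(ℝ, 𝔼 n) 𝓘(ℝ, 𝔼 n) R v = (R : (𝔼 n) →L[ℝ] (𝔼 n)) := fun v => by
    rw [mfderiv_eq_fderiv]
    exact (R : (𝔼 n) →L[ℝ] (𝔼 n)).fderiv
  have hRdet : ∀ v, LinearMap.det (M := 𝔼 n)
      (mfderiv 𝓘(ℝ, 𝔼 n) 𝓘(ℝ, 𝔼 n) R v).toLinearMap < 0 := fun v => by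
    rw [hRd v]
    exact hR
  have hRo : IsOrientationPreserving (SmoothOrientation.modelSpace o)
      (SmoothOrientation.modelSpace (-o)) R := fun v =>
    orientationAt_of_det_neg (hRdet v)
  have hi' : IsOrientationPreserving (SmoothOrientation.modelSpace (-o)) (-oM) i := by
    rw [← SmoothOrientation.neg_modelSpace, isOrientationPreserving_neg_neg_iff]
    exact h
  have hcomp := IsOrientationPreserving.comp_holds hi' hRo
    (fun v => (hi.contMDiff v).mdifferentiableAt (by simp))
    (fun v => (((R : (𝔼 n) →L[ℝ] (𝔼 n)).contDiff (n := (∞ : WithTop ℕ∞))).contMDiff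
      v).mdifferentiableAt (by simp))
    (fun v => det_mfderiv_ne_zero_of_isSmoothEmbedding hi ho v) (fun v => (hRdet v).ne)
  rw [isOrientationReversing_iff]
  exact hcomp

end Disc

/-! ### Oriented connected sum data -/

section OrientedData

variable {n : ℕ} {M N : Type u} [TopologicalSpace M] [ChartedSpace (𝔼 n) M]
  [IsManifold (𝓡 n) ∞ M] [TopologicalSpace N] [ChartedSpace (𝔼 n) N] [IsManifold (𝓡 n) ∞ N]

/-- **Oriented connected sum data exist.** For oriented nonempty smooth `n`-manifolds `M`, `N`,
`n ≠ 0`, there are connected sum data (charts onto `ℝⁿ`) whose first disc `i₁ : ℝⁿ → M` preserves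
and whose second disc `i₂ : ℝⁿ → N` reverses orientation for one and the same constant
orientation `o₀` of `ℝⁿ`: choose `o₀` by `i₁`, and if `i₂` then preserves rather than reverses,
precompose it with a reflection (Kervaire–Milnor, *Groups of homotopy spheres I* (1963), §2,
p. 505: "imbeddings `i₁ : Dⁿ → M₁`, `i₂ : Dⁿ → M₂` … so that `i₁` preserves orientation and `i₂`
reverses orientation"; Kosinski VI.1). [cite: KervaireMilnor1963, §2] -/
theorem exists_connectedSumData_oriented (hn : n ≠ 0) [Nonempty M] [Nonempty N]
    (oM : SmoothOrientation (𝓡 n) M) (oN : SmoothOrientation (𝓡 n) N) :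
    ∃ (D : ConnectedSumData n M N) (o₀ : Orientation ℝ (𝔼 n) (Fin (finrank ℝ (𝔼 n)))),
      IsOrientationPreserving (SmoothOrientation.modelSpace o₀) oM D.i₁ ∧
        IsOrientationReversing (SmoothOrientation.modelSpace o₀) oN D.i₂ := by
  obtain ⟨D⟩ := nonempty_connectedSumData (n := n) (M := M) (N := N)
  obtain ⟨o₀, h₁⟩ := exists_isOrientationPreserving_disc D.isSmoothEmbedding_i₁ D.isOpen_range_i₁ oM
  rcases isOrientationPreserving_or_isOrientationReversing_disc D.isSmoothEmbedding_i₂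
    D.isOpen_range_i₂ o₀ oN with h₂ | h₂
  · obtain ⟨R, hR⟩ := exists_linearIsometryEquiv_det_eq_neg_one hn
    have hRs : LinearMap.det (R.symm.toLinearEquiv : (𝔼 n) →ₗ[ℝ] (𝔼 n)) < 0 := by
      have h : LinearMap.det (R.symm.toLinearEquiv : (𝔼 n) →ₗ[ℝ] (𝔼 n)) =
          (LinearMap.det (R.toLinearEquiv : (𝔼 n) →ₗ[ℝ] (𝔼 n)))⁻¹ :=
        LinearEquiv.det_coe_symm R.toLinearEquiv
      rw [h, hR]
      norm_num
    refine ⟨D.reflectRight R, o₀, h₁, ?_⟩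
    rw [D.reflectRight_i₂]
    exact isOrientationReversing_disc_comp D.isSmoothEmbedding_i₂ D.isOpen_range_i₂ h₂ R.symm hRs
  · exact ⟨D, o₀, h₁, h₂⟩

end OrientedData

/-! ### The glued manifold of connected sum data, and its orientation -/

section Glued

variable {n : ℕ} {M : Type u} {N : Type v} [TopologicalSpace M] [ChartedSpace (𝔼 n) M]
  [TopologicalSpace N] [ChartedSpace (𝔼 n) N]

/-- Propositional bookkeeping for the agreement of the two transported orientations on the
overlap of the pieces of a connected sum. [folklore] -/
theorem glue_bookkeeping {F : Type*} [NormedAddCommGroup F] [NormedSpace ℝ F]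
    {X A Y B : Orientation ℝ F (Fin (finrank ℝ F))} {dA dB dg : Prop}
    (E1 : X = A ↔ dA) (E2 : Y = B ↔ dB) (E3 : B = A ↔ dg) (E6 : dA ↔ (dB ↔ dg)) : X = Y := by
  rw [orientation_eq_iff_eq_iff_eq X A Y, E1, orientation_eq_iff_eq_iff_eq A B Y,
    eq_comm (a := A) (b := B), E3, eq_comm (a := B) (b := Y), E2, E6]
  exact Iff.comm

namespace ConnectedSumData

variable (D : ConnectedSumData n M N) (hn : n ≠ 0)

/-! #### Differentiability of the charts, discs and identification -/

/-- `Φ` is differentiable on its (open) source. [folklore] -/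
theorem mdifferentiableAt_Φ {p : M} (hp : p ∈ D.Φ.source) :
    MDifferentiableAt (𝓡 n) (𝓡 n) D.Φ p :=
  (D.contMDiffOn_Φ.contMDiffAt (D.Φ.open_source.mem_nhds hp)).mdifferentiableAt (by simp)

/-- The chart `e₁` is differentiable on its source. [folklore] -/
theorem mdifferentiableAt_e₁ {p : M} (hp : p ∈ D.e₁.source) :
    MDifferentiableAt (𝓡 n) (𝓡 n) D.e₁ p :=
  ((contMDiffOn_of_mem_maximalAtlas D.mem_maximalAtlas₁).contMDiffAt
    (D.e₁.open_source.mem_nhds hp)).mdifferentiableAt (by simp)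

/-- The disc `i₁` is differentiable. [folklore] -/
theorem mdifferentiableAt_i₁ (v : 𝔼 n) : MDifferentiableAt (𝓡 n) (𝓡 n) D.i₁ v :=
  (D.isSmoothEmbedding_i₁.contMDiff v).mdifferentiableAt (by simp)

/-- The disc `i₂` is differentiable. [folklore] -/
theorem mdifferentiableAt_i₂ (v : 𝔼 n) : MDifferentiableAt (𝓡 n) (𝓡 n) D.i₂ v :=
  (D.isSmoothEmbedding_i₂.contMDiff v).mdifferentiableAt (by simp)

/-- `d(e₁)_p ∘ d(i₁)_{e₁ p} = id` on the source of `e₁`: the Jacobians multiply to `1`. [folklore] -/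
theorem det_mfderiv_e₁_mul {p : M} (hp : p ∈ D.e₁.source) :
    LinearMap.det (M := 𝔼 n) (mfderiv (𝓡 n) (𝓡 n) D.e₁ p).toLinearMap *
      LinearMap.det (M := 𝔼 n) (mfderiv (𝓡 n) (𝓡 n) D.i₁ (D.e₁ p)).toLinearMap = 1 := by
  apply det_mul_det_eq_one_of_comp_eq_id
  have hid : (D.e₁ : M → 𝔼 n) ∘ D.i₁ = id := funext fun v => D.e₁_i₁ v
  have hv : D.i₁ (D.e₁ p) = p := D.i₁_e₁ hp
  have h := mfderiv_comp (D.e₁ p) (I := 𝓡 n) (I' := 𝓡 n) (I'' := 𝓡 n) (hv ▸ D.mdifferentiableAt_e₁ hp)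
    (D.mdifferentiableAt_i₁ (D.e₁ p))
  rw [hid, mfderiv_id] at h
  rw [hv] at h
  exact h.symm

/-- **The chart `e₁` is orientation preserving at points of its source** when `i₁ = e₁⁻¹`
preserves the orientations `(o₀, oM)` (inverse Jacobians have the same sign). [folklore] -/
theorem orientationAt_e₁ [IsManifold (𝓡 n) ∞ M] {o₀ : Orientation ℝ (𝔼 n) (Fin (finrank ℝ (𝔼 n)))}
    {oM : SmoothOrientation (𝓡 n) M}
    (h₁ : IsOrientationPreserving (SmoothOrientation.modelSpace o₀) oM D.i₁) {p : M}
    (hp : p ∈ D.e₁.source) :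
    (SmoothOrientation.modelSpace o₀ (D.e₁ p) = oM p ↔
      0 < LinearMap.det (M := 𝔼 n) (mfderiv (𝓡 n) (𝓡 n) D.e₁ p).toLinearMap) := by
  have hmul := D.det_mfderiv_e₁_mul hp
  have ha0 := left_ne_zero_of_mul_eq_one hmul
  have hb0 := right_ne_zero_of_mul_eq_one hmul
  have hsign := (mul_pos_iff_pos_iff_pos ha0 hb0).mp (hmul ▸ one_pos)
  have h := h₁ (D.e₁ p)
  rw [D.i₁_e₁ hp] at h
  -- `h : oM p = o₀ ↔ 0 < det d(i₁)`
  simp only [SmoothOrientation.modelSpace_apply] at h ⊢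
  rw [eq_comm, h]
  exact hsign.symm

variable [T2Space M] [T2Space N] [IsManifold (𝓡 n) ∞ M] [IsManifold (𝓡 n) ∞ N]

/-- The smooth gluing datum `⟨φ, _, _, id, id⟩` of the connected sum in positive dimension (as in
`exists_isConnectedSum_of_ne_zero`; Kervaire–Milnor 1963, §2; Kosinski VI.(1.1)). [cite: KervaireMilnor1963, §2] -/
def glueData : SmoothGlueData (𝓡 n) (𝓡 n) D.A D.B (𝔼 n) :=
  ⟨D.φ hn, D.contMDiffOn_φ hn, D.contMDiffOn_φ_symm hn, ContinuousLinearEquiv.refl ℝ _,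
    ContinuousLinearEquiv.refl ℝ _⟩

omit [IsManifold (𝓡 n) ∞ M] [IsManifold (𝓡 n) ∞ N] in
/-- The gluing map of `glueData` is `φ`. [folklore] -/
@[simp] theorem glueData_glue : (D.glueData hn).glue = D.φ hn := rfl

/-- The connected sum manifold `M # N = (M ∖ {i₁ 0}) ∪_φ (N ∖ {i₂ 0})` of the data (positive
dimension): the glued space of `glueData`, a smooth `n`-manifold (Kervaire–Milnor 1963, §2;
Kosinski VI.(1.1)). [cite: KervaireMilnor1963, §2] -/
abbrev Glued : Type (max u v) := (D.glueData hn).Glued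

omit [IsManifold (𝓡 n) ∞ M] [IsManifold (𝓡 n) ∞ N] in
/-- `M # N` is Hausdorff (the graph of `φ` is closed; Kosinski VI.(1.1)). [cite: Kosinski1993, Ch. VI §1, Thm (1.1)] -/
theorem t2Space_glued : T2Space (D.Glued hn) :=
  (D.glueData hn).t2Space_of_isClosed_graph (D.isClosed_graph_φ hn)

omit [IsManifold (𝓡 n) ∞ M] [IsManifold (𝓡 n) ∞ N] in
/-- `M # N` is compact for closed `M`, `N` (it is covered by the images of `M ∖ i₁ B_½` and
`N ∖ i₂ B_½`; Kervaire–Milnor 1963, §2). [cite: KervaireMilnor1963, §2] -/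
theorem compactSpace_glued [CompactSpace M] [CompactSpace N] : CompactSpace (D.Glued hn) :=
  (D.glueData hn).compactSpace_of_forall_not_mem D.isCompact_K₁ D.isCompact_K₂
    (fun _ ha => D.φ_mem_K₂ hn ha) fun _ hb => D.φ_symm_mem_K₁ hn hb

/-- `M # N` is second countable for closed `M`, `N`. [folklore] -/
theorem secondCountableTopology_glued [CompactSpace M] [CompactSpace N] :
    SecondCountableTopology (D.Glued hn) := by
  haveI := D.compactSpace_glued hn
  exact (D.glueData hn).secondCountableTopology

/-- The first open piece `jA (M ∖ {i₁ 0}) ⊆ M # N`. [cite: KervaireMilnor1963, §2] -/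
abbrev UA : TopologicalSpace.Opens (D.Glued hn) :=
  rangeOpens (D.glueData hn).inl (D.glueData hn).isOpen_range_inl

/-- The second open piece `jB (N ∖ {i₂ 0}) ⊆ M # N`. [cite: KervaireMilnor1963, §2] -/
abbrev UB : TopologicalSpace.Opens (D.Glued hn) :=
  rangeOpens (D.glueData hn).inr (D.glueData hn).isOpen_range_inr

/-- The first piece is diffeomorphic to its image in `M # N`. [folklore] -/
def ψA : D.A ≃ₘ⟮𝓡 n, 𝓡 n⟯ (D.UA hn) :=
  rangeDiffeomorph (D.glueData hn).isSmoothEmbedding_inl (D.glueData hn).isOpen_range_inl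

/-- The second piece is diffeomorphic to its image in `M # N`. [folklore] -/
def ψB : D.B ≃ₘ⟮𝓡 n, 𝓡 n⟯ (D.UB hn) :=
  rangeDiffeomorph (D.glueData hn).isSmoothEmbedding_inr (D.glueData hn).isOpen_range_inr

/-- `ψA` is `jA = inl` followed by the inclusion. [folklore] -/
theorem coe_ψA (a : D.A) : ((D.ψA hn a : D.UA hn) : D.Glued hn) = (D.glueData hn).inl a := rfl

/-- `ψB` is `jB = inr` followed by the inclusion. [folklore] -/
theorem coe_ψB (b : D.B) : ((D.ψB hn b : D.UB hn) : D.Glued hn) = (D.glueData hn).inr b := rfl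

/-- `jA = inl` is differentiable. [folklore] -/
theorem mdifferentiableAt_inl (a : D.A) :
    MDifferentiableAt (𝓡 n) (𝓡 n) (D.glueData hn).inl a :=
  ((D.glueData hn).contMDiff_inl a).mdifferentiableAt (by simp)

/-- `jB = inr` is differentiable. [folklore] -/
theorem mdifferentiableAt_inr (b : D.B) :
    MDifferentiableAt (𝓡 n) (𝓡 n) (D.glueData hn).inr b :=
  ((D.glueData hn).contMDiff_inr b).mdifferentiableAt (by simp)

/-- `d(ψA) = d(jA)`. [folklore] -/
theorem mfderiv_ψA (a : D.A) :
    mfderiv (𝓡 n) (𝓡 n) (D.ψA hn) a = mfderiv (𝓡 n) (𝓡 n) (D.glueData hn).inl a :=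
  mfderiv_codRestrict_opens_eq (D.coe_ψA hn) (D.mdifferentiableAt_inl hn a)

/-- `d(ψB) = d(jB)`. [folklore] -/
theorem mfderiv_ψB (b : D.B) :
    mfderiv (𝓡 n) (𝓡 n) (D.ψB hn) b = mfderiv (𝓡 n) (𝓡 n) (D.glueData hn).inr b :=
  mfderiv_codRestrict_opens_eq (D.coe_ψB hn) (D.mdifferentiableAt_inr hn b)

/-- `jA` has invertible differential. [folklore] -/
theorem det_mfderiv_inl_ne_zero (a : D.A) :
    LinearMap.det (M := 𝔼 n) (mfderiv (𝓡 n) (𝓡 n) (D.glueData hn).inl a).toLinearMap ≠ 0 :=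
  det_mfderiv_ne_zero_of_isSmoothEmbedding (D.glueData hn).isSmoothEmbedding_inl
    (D.glueData hn).isOpen_range_inl a

/-- `jB` has invertible differential. [folklore] -/
theorem det_mfderiv_inr_ne_zero (b : D.B) :
    LinearMap.det (M := 𝔼 n) (mfderiv (𝓡 n) (𝓡 n) (D.glueData hn).inr b).toLinearMap ≠ 0 :=
  det_mfderiv_ne_zero_of_isSmoothEmbedding (D.glueData hn).isSmoothEmbedding_inr
    (D.glueData hn).isOpen_range_inr b

/-! #### The gluing map preserves orientation -/

omit [IsManifold (𝓡 n) ∞ M] [IsManifold (𝓡 n) ∞ N] in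
/-- `φ` is differentiable on its (open) source. [folklore] -/
theorem mdifferentiableAt_φ {a : D.A} (ha : a ∈ (D.φ hn).source) :
    MDifferentiableAt (𝓡 n) (𝓡 n) (D.φ hn) a :=
  ((D.contMDiffOn_φ hn).contMDiffAt ((D.φ hn).open_source.mem_nhds ha)).mdifferentiableAt
    (by simp)

omit [IsManifold (𝓡 n) ∞ M] [IsManifold (𝓡 n) ∞ N] in
/-- `dφ = dΦ` on the source. [folklore] -/
theorem mfderiv_φ {a : D.A} (ha : a ∈ (D.φ hn).source) :
    mfderiv (𝓡 n) (𝓡 n) (D.φ hn) a = mfderiv (𝓡 n) (𝓡 n) D.Φ (a : M) := by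
  apply mfderiv_opens_eq_of_eventuallyEq
  · filter_upwards [(D.φ hn).open_source.mem_nhds ha] with y hy
    exact D.coe_φ hn hy
  · exact D.mdifferentiableAt_Φ ((D.mem_φ_source hn).1 ha)

/-- The orientation of the first open piece of `M # N` transported from `oM` (Kosinski VI.(1.1):
"`M₁ # M₂` is … oriented if both `M₁`, `M₂` are oriented"). [cite: Kosinski1993, Ch. VI §1, Thm (1.1)] -/
def oUA (oM : SmoothOrientation (𝓡 n) M) : SmoothOrientation (𝓡 n) (D.UA hn) :=
  (oM.restrict D.A).map (D.ψA hn) (by simp)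

/-- The orientation of the second open piece of `M # N` transported from `oN`. [cite: Kosinski1993, Ch. VI §1, Thm (1.1)] -/
def oUB (oN : SmoothOrientation (𝓡 n) N) : SmoothOrientation (𝓡 n) (D.UB hn) :=
  (oN.restrict D.B).map (D.ψB hn) (by simp)

/-- **The gluing map `φ` of a connected sum with `i₁` orientation preserving and `i₂` orientation
reversing is orientation preserving** (at every point of its source, for the restricted
orientations): `φ = i₂ ∘ ψ ∘ e₁` with `e₁` preserving, the disc inversion `ψ` reversing
(`Literature.Topology.FourManifolds.det_fderiv_discInversionFun_neg`) and `i₂` reversing (Kervaire–Milnor 1963, §2: this is why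
`i₂` is taken orientation reversing; Kosinski VI.(1.1)). [cite: KervaireMilnor1963, §2] -/
theorem orientationAt_φ {o₀ : Orientation ℝ (𝔼 n) (Fin (finrank ℝ (𝔼 n)))}
    {oM : SmoothOrientation (𝓡 n) M} {oN : SmoothOrientation (𝓡 n) N}
    (h₁ : IsOrientationPreserving (SmoothOrientation.modelSpace o₀) oM D.i₁)
    (h₂ : IsOrientationReversing (SmoothOrientation.modelSpace o₀) oN D.i₂)
    {a : D.A} (ha : a ∈ (D.φ hn).source) :
    (oN ((D.φ hn a : D.B) : N) = oM (a : M) ↔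
      0 < LinearMap.det (M := 𝔼 n) (mfderiv (𝓡 n) (𝓡 n) (D.φ hn) a).toLinearMap) := by
  obtain ⟨hpe, hu0, hu1⟩ := (D.mem_Φ_source).1 ((D.mem_φ_source hn).1 ha)
  set p : M := (a : M) with hp_def
  set u : 𝔼 n := D.e₁ p with hu_def
  have hu : u ≠ 0 := norm_pos_iff.1 hu0
  -- the three maps
  have he₁ := D.orientationAt_e₁ h₁ hpe
  have he₁d := D.mdifferentiableAt_e₁ hpe
  have he₁0 := left_ne_zero_of_mul_eq_one (D.det_mfderiv_e₁_mul hpe)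
  have hψd : MDifferentiableAt (𝓡 n) (𝓡 n) (discInversionFun : 𝔼 n → 𝔼 n) u :=
    ((contDiffAt_discInversionFun hu).differentiableAt (by simp)).mdifferentiableAt
  have hψdet : LinearMap.det (M := 𝔼 n)
      (mfderiv (𝓡 n) (𝓡 n) (discInversionFun : 𝔼 n → 𝔼 n) u).toLinearMap < 0 := by
    rw [mfderiv_eq_fderiv]
    exact det_fderiv_discInversionFun_neg hn hu0 hu1
  have hψ : (SmoothOrientation.modelSpace (-o₀) (discInversionFun u) =
      SmoothOrientation.modelSpace o₀ u ↔ 0 < LinearMap.det (M := 𝔼 n)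
        (mfderiv (𝓡 n) (𝓡 n) (discInversionFun : 𝔼 n → 𝔼 n) u).toLinearMap) :=
    orientationAt_of_det_neg hψdet
  -- `ψ ∘ e₁` at `p`
  have hc1 := orientationAt_comp (oM := oM) (oN := SmoothOrientation.modelSpace o₀)
    (oP := SmoothOrientation.modelSpace (-o₀)) (f := D.e₁) (g := discInversionFun) (x := p)
    he₁d hψd he₁0 hψdet.ne he₁ hψ
  have hc1d : MDifferentiableAt (𝓡 n) (𝓡 n) (discInversionFun ∘ D.e₁) p := hψd.comp p he₁d
  have hc10 : LinearMap.det (M := 𝔼 n)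
      (mfderiv (𝓡 n) (𝓡 n) (discInversionFun ∘ D.e₁) p).toLinearMap ≠ 0 := by
    have hcomp : mfderiv (𝓡 n) (𝓡 n) (discInversionFun ∘ D.e₁) p =
        (mfderiv (𝓡 n) (𝓡 n) (discInversionFun : 𝔼 n → 𝔼 n) (D.e₁ p)).comp
          (mfderiv (𝓡 n) (𝓡 n) D.e₁ p) := mfderiv_comp p hψd he₁d
    rw [hcomp]
    have hdet' : LinearMap.det (M := 𝔼 n)
        ((mfderiv (𝓡 n) (𝓡 n) (discInversionFun : 𝔼 n → 𝔼 n) (D.e₁ p)).comp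
          (mfderiv (𝓡 n) (𝓡 n) D.e₁ p)).toLinearMap =
        LinearMap.det (M := 𝔼 n)
          (mfderiv (𝓡 n) (𝓡 n) (discInversionFun : 𝔼 n → 𝔼 n) (D.e₁ p)).toLinearMap *
          LinearMap.det (M := 𝔼 n) (mfderiv (𝓡 n) (𝓡 n) D.e₁ p).toLinearMap :=
      LinearMap.det_comp (M := 𝔼 n) _ _
    rw [hdet']
    exact mul_ne_zero hψdet.ne he₁0
  -- `i₂` at `ψ u`
  have hi₂ : IsOrientationPreserving (SmoothOrientation.modelSpace (-o₀)) oN D.i₂ := by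
    rw [← SmoothOrientation.neg_modelSpace, ← isOrientationReversing_iff_neg]
    exact h₂
  have hi₂d := D.mdifferentiableAt_i₂ (discInversionFun u)
  have hi₂0 := det_mfderiv_ne_zero_of_isSmoothEmbedding D.isSmoothEmbedding_i₂ D.isOpen_range_i₂
    (discInversionFun u)
  have hc2 := orientationAt_comp (oM := oM) (oN := SmoothOrientation.modelSpace (-o₀))
    (oP := oN) (f := discInversionFun ∘ D.e₁) (g := D.i₂) (x := p) hc1d hi₂d hc10 hi₂0 hc1
    (hi₂ (discInversionFun u))
  -- `Φ = i₂ ∘ ψ ∘ e₁`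
  have hΦ : (D.Φ : M → N) = D.i₂ ∘ (discInversionFun ∘ D.e₁) := funext fun q => D.Φ_apply q
  rw [D.mfderiv_φ hn ha, D.coe_φ hn ha, hΦ]
  exact hc2

/-! #### Agreement of the transported orientations on the overlap -/

/-- **The orientations transported from `M` and from `N` agree on the overlap** of the two pieces
of `M # N` (the gluing map is orientation preserving, `orientationAt_φ`, and `jA = jB ∘ φ` there;
Kosinski VI.(1.1)). [cite: Kosinski1993, Ch. VI §1, Thm (1.1)] -/
theorem oUA_eq_oUB {o₀ : Orientation ℝ (𝔼 n) (Fin (finrank ℝ (𝔼 n)))}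
    {oM : SmoothOrientation (𝓡 n) M} {oN : SmoothOrientation (𝓡 n) N}
    (h₁ : IsOrientationPreserving (SmoothOrientation.modelSpace o₀) oM D.i₁)
    (h₂ : IsOrientationReversing (SmoothOrientation.modelSpace o₀) oN D.i₂)
    (p : D.Glued hn) (hA : p ∈ D.UA hn) (hB : p ∈ D.UB hn) :
    D.oUA hn oM ⟨p, hA⟩ = D.oUB hn oN ⟨p, hB⟩ := by
  set d := D.glueData hn with hd
  obtain ⟨a, rfl⟩ := id hA
  obtain ⟨b, hb⟩ := id hB
  obtain ⟨has, hgab⟩ := d.inl_eq_inr_iff.1 hb.symm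
  have has' : a ∈ (D.φ hn).source := has
  have hgab' : D.φ hn a = b := hgab
  subst hgab'
  have hpA : (⟨d.inl a, hA⟩ : D.UA hn) = D.ψA hn a := rfl
  have hpB : (⟨d.inl a, hB⟩ : D.UB hn) = D.ψB hn (D.φ hn a) := Subtype.ext hb.symm
  rw [hpA, hpB]
  -- (E1), (E2): `ψA`, `ψB` are orientation preserving towards the transported orientations
  have E1 := SmoothOrientation.isOrientationPreserving_map (oM.restrict D.A) (D.ψA hn) (by simp) a
  have E2 := SmoothOrientation.isOrientationPreserving_map (oN.restrict D.B) (D.ψB hn) (by simp)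
    (D.φ hn a)
  rw [D.mfderiv_ψA hn] at E1
  rw [D.mfderiv_ψB hn] at E2
  simp only [SmoothOrientation.restrict_apply] at E1 E2
  -- (E3): the gluing map preserves orientation at `a`
  have E3 := D.orientationAt_φ hn h₁ h₂ has'
  -- (E4): `jA = jB ∘ φ` near `a`, chain rule
  have hev : d.inl =ᶠ[𝓝 a] d.inr ∘ D.φ hn := by
    filter_upwards [(D.φ hn).open_source.mem_nhds has'] with y hy
    exact (d.inr_glue hy).symm
  have hgd := D.mdifferentiableAt_φ hn has'
  have hchain : mfderiv (𝓡 n) (𝓡 n) d.inl a =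
      (mfderiv (𝓡 n) (𝓡 n) d.inr (D.φ hn a)).comp (mfderiv (𝓡 n) (𝓡 n) (D.φ hn) a) := by
    rw [hev.mfderiv_eq]
    exact mfderiv_comp a (D.mdifferentiableAt_inr hn _) hgd
  have hdet : LinearMap.det (M := 𝔼 n) (mfderiv (𝓡 n) (𝓡 n) d.inl a).toLinearMap =
      LinearMap.det (M := 𝔼 n) (mfderiv (𝓡 n) (𝓡 n) d.inr (D.φ hn a)).toLinearMap *
        LinearMap.det (M := 𝔼 n) (mfderiv (𝓡 n) (𝓡 n) (D.φ hn) a).toLinearMap := by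
    rw [hchain]
    exact LinearMap.det_comp (M := 𝔼 n) _ _
  have hA0 := D.det_mfderiv_inl_ne_zero hn a
  have hB0 := D.det_mfderiv_inr_ne_zero hn (D.φ hn a)
  have hg0 : LinearMap.det (M := 𝔼 n) (mfderiv (𝓡 n) (𝓡 n) (D.φ hn) a).toLinearMap ≠ 0 := by
    intro h0
    rw [h0, mul_zero] at hdet
    exact hA0 hdet
  -- (E6): signs
  have E6 := (mul_pos_iff_pos_iff_pos hB0 hg0)
  rw [← hdet] at E6
  exact glue_bookkeeping E1 E2 E3 E6

/-- **The orientation of `M # N`** glued from the orientations transported from `M` and `N`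
(Kosinski, *Differential Manifolds* (1993), VI.(1.1): "`M₁ # M₂` is … oriented if both `M₁`, `M₂`
are oriented"; Kervaire–Milnor 1963, §2). [cite: Kosinski1993, Ch. VI §1, Thm (1.1)] -/
def orientation (oM : SmoothOrientation (𝓡 n) M) (oN : SmoothOrientation (𝓡 n) N)
    (o₀ : Orientation ℝ (𝔼 n) (Fin (finrank ℝ (𝔼 n))))
    (h₁ : IsOrientationPreserving (SmoothOrientation.modelSpace o₀) oM D.i₁)
    (h₂ : IsOrientationReversing (SmoothOrientation.modelSpace o₀) oN D.i₂) :
    SmoothOrientation (𝓡 n) (D.Glued hn) :=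
  SmoothOrientation.glue (D.UA hn) (D.UB hn) (D.oUA hn oM) (D.oUB hn oN)
    (fun p => (eq_univ_iff_forall.1 (D.glueData hn).range_inl_union_range_inr p).elim
      Or.inl Or.inr)
    fun p hA hB => D.oUA_eq_oUB hn h₁ h₂ p hA hB

/-- `jA : (M ∖ {i₁ 0}, oM) → (M # N, o)` is orientation preserving. [cite: Kosinski1993, Ch. VI §1, Thm (1.1)] -/
theorem isOrientationPreserving_inl (oM : SmoothOrientation (𝓡 n) M)
    (oN : SmoothOrientation (𝓡 n) N) (o₀ : Orientation ℝ (𝔼 n) (Fin (finrank ℝ (𝔼 n))))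
    (h₁ : IsOrientationPreserving (SmoothOrientation.modelSpace o₀) oM D.i₁)
    (h₂ : IsOrientationReversing (SmoothOrientation.modelSpace o₀) oN D.i₂) :
    IsOrientationPreserving (oM.restrict (puncture D.i₁)) (D.orientation hn oM oN o₀ h₁ h₂)
      (D.glueData hn).inl := by
  intro a
  have hmem : (D.glueData hn).inl a ∈ D.UA hn := mem_range_self a
  rw [orientation, SmoothOrientation.glue_apply_of_mem_left hmem]
  have E1 := SmoothOrientation.isOrientationPreserving_map (oM.restrict D.A) (D.ψA hn) (by simp) a
  rw [D.mfderiv_ψA hn] at E1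
  exact E1

/-- `jB : (N ∖ {i₂ 0}, oN) → (M # N, o)` is orientation preserving. [cite: Kosinski1993, Ch. VI §1, Thm (1.1)] -/
theorem isOrientationPreserving_inr (oM : SmoothOrientation (𝓡 n) M)
    (oN : SmoothOrientation (𝓡 n) N) (o₀ : Orientation ℝ (𝔼 n) (Fin (finrank ℝ (𝔼 n))))
    (h₁ : IsOrientationPreserving (SmoothOrientation.modelSpace o₀) oM D.i₁)
    (h₂ : IsOrientationReversing (SmoothOrientation.modelSpace o₀) oN D.i₂) :
    IsOrientationPreserving (oN.restrict (puncture D.i₂)) (D.orientation hn oM oN o₀ h₁ h₂)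
      (D.glueData hn).inr := by
  intro b
  have hmem : (D.glueData hn).inr b ∈ D.UB hn := mem_range_self b
  rw [orientation, SmoothOrientation.glue_apply_of_mem_right hmem]
  have E2 := SmoothOrientation.isOrientationPreserving_map (oN.restrict D.B) (D.ψB hn) (by simp) b
  rw [D.mfderiv_ψB hn] at E2
  exact E2

/-- **The glued manifold is an oriented connected sum** `(M, oM) # (N, oN)` for data with `i₁`
orientation preserving and `i₂` orientation reversing (Kervaire–Milnor 1963, §2; Kosinski
VI.(1.1)). [cite: KervaireMilnor1963, §2] -/
theorem isOrientedConnectedSum_glued (oM : SmoothOrientation (𝓡 n) M)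
    (oN : SmoothOrientation (𝓡 n) N) (o₀ : Orientation ℝ (𝔼 n) (Fin (finrank ℝ (𝔼 n))))
    (h₁ : IsOrientationPreserving (SmoothOrientation.modelSpace o₀) oM D.i₁)
    (h₂ : IsOrientationReversing (SmoothOrientation.modelSpace o₀) oN D.i₂) :
    IsOrientedConnectedSum oM oN (D.orientation hn oM oN o₀ h₁ h₂) :=
  ⟨D.i₁, D.i₂, o₀, (D.glueData hn).inl, (D.glueData hn).inr, D.isSmoothEmbedding_i₁,
    D.isSmoothEmbedding_i₂, h₁, h₂,
    ⟨(D.glueData hn).isSmoothEmbedding_inl, (D.glueData hn).isOpen_range_inl,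
      (D.glueData hn).isSmoothEmbedding_inr, (D.glueData hn).isOpen_range_inr,
      (D.glueData hn).range_inl_union_range_inr,
      fun a b => (D.glueData hn).inl_eq_inr_iff.trans (D.connectedSumRel_iff_φ hn a b).symm⟩,
    D.isOrientationPreserving_inl hn oM oN o₀ h₁ h₂,
    D.isOrientationPreserving_inr hn oM oN o₀ h₁ h₂⟩

end ConnectedSumData

/-! ### Existence of oriented connected sums -/

/-- **Existence of oriented connected sums**: discharge of the named fact
`Literature.Topology.FourManifolds.exists_isOrientedConnectedSum` (Kervaire–Milnor, *Groups of homotopy spheres I*, Ann. of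
Math. 77 (1963), §2, p. 505; Kosinski, *Differential Manifolds* (1993), Ch. VI §1, Thm (1.1):
"`M₁ # M₂` is a smooth manifold, connected if `m > 1` and oriented if both `M₁`, `M₂` are
oriented"). Given oriented nonempty closed smooth `n`-manifolds `M`, `N`, `n ≠ 0`: choose connected
sum data with `i₁` orientation preserving and `i₂` orientation reversing
(`exists_connectedSumData_oriented`, a reflection of `ℝⁿ` makes `i₂` reversing), glue the
punctured pieces along Kervaire–Milnor's identification (the pushout `Literature.Topology.FourManifolds.SmoothGlueData.Glued`,
Hausdorff, compact and second countable as in `exists_isConnectedSum_holds`), and orient the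
result by gluing the orientations transported from the two pieces, which agree on the overlap
because the identification `i₂ ∘ ψ ∘ e₁` preserves orientation (`ψ` and `i₂` reverse, `e₁`
preserves). [cite: Kosinski1993, Ch. VI §1, Thm (1.1)] -/
theorem exists_isOrientedConnectedSum_holds : exists_isOrientedConnectedSum.{u} (n := n) := by
  intro hn M N _ _ _ _ _ _ _ _ _ _ _ _ _ _ oM oN
  obtain ⟨D, o₀, h₁, h₂⟩ := exists_connectedSumData_oriented hn oM oN
  haveI := D.t2Space_glued hn
  haveI := D.compactSpace_glued hn
  haveI := D.secondCountableTopology_glued hn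
  exact ⟨D.Glued hn, inferInstance, inferInstance, inferInstance, inferInstance, inferInstance,
    inferInstance, D.orientation hn oM oN o₀ h₁ h₂, D.isOrientedConnectedSum_glued hn oM oN o₀ h₁ h₂⟩

end Glued

end Literature.Topology.FourManifolds
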